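import Literature.AlgebraicGeometry.Resolution.Blowups
import Literature.AlgebraicGeometry.Motives.Varieties
import Mathlib.AlgebraicGeometry.IdealSheaf.Functorial
import HarnessLib

/-!
# Effective Cartier ideals from charts on the support; kernels of whiskered closed immersions

Topic `Literature/AlgebraicGeometry/Motives`; theorem-only helpers for the product-centre blow-up
(`Motives/TensorCentreHosts`):

* `isEffectiveCartier_of_forall_mem_support` — an ideal sheaf which is principal with a
  nonzerodivisor generator on affine charts around the points OF ITS SUPPORT is an effective
  Cartier divisor (off the support it is the unit ideal);
* `ker_whiskerRight_left` — for a closed `k`-immersion `f : X ↪ X'` and a `k`-scheme `T`,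
  `ker (f ▷ T) = pr₁⁻¹(ker f) · 𝒪_{X' ⊗ T}` (the square `X ⊗ T → X' ⊗ T → X'` is cartesian and
  the kernel of a base change of a closed immersion is the inverse image ideal,
  Mathlib `ker_fst_of_isClosedImmersion`).

## References

* U. Görtz, T. Wedhorn, *Algebraic Geometry I* (2020), (13.19) and Remark 11.27 (effective
  Cartier divisors), Prop. 4.20 (base change of closed immersions). [GortzWedhorn2020]
-/

noncomputable section

open CategoryTheory CategoryTheory.Limits AlgebraicGeometry MonoidalCategory

namespace Literature.AlgebraicGeometry.Motives

open Literature.AlgebraicGeometry.Resolution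

/-- **An ideal sheaf which is cut out by one nonzerodivisor on affine charts around every point of
its support is an effective Cartier divisor**: around a point off the (closed) support there is an
affine open missing the support, on which the ideal is the unit ideal `(1)`.
[cite: GortzWedhorn2020, (13.19) p. 413 with Remark 11.27] -/
theorem isEffectiveCartier_of_forall_mem_support {X : Scheme} (K : X.IdealSheafData)
    (h : ∀ x ∈ K.support, ∃ U : X.affineOpens, x ∈ (U : X.Opens) ∧
      ∃ f : Γ(X, U), f ∈ nonZeroDivisors Γ(X, U) ∧ K.ideal U = Ideal.span {f}) :
    IsEffectiveCartier K := by
  intro x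
  by_cases hx : x ∈ K.support
  · exact h x hx
  · -- an affine neighbourhood missing the support
    obtain ⟨U, hU, hxU, hUs⟩ := exists_isAffineOpen_mem_and_subset (X := X) (x := x)
      (U := K.support.compl) hx
    refine ⟨⟨U, hU⟩, hxU, 1, one_mem _, ?_⟩
    have h0 : X.zeroLocus (U := U) (K.ideal ⟨U, hU⟩ : Set Γ(X, U)) ∩ U = ∅ := by
      rw [← Scheme.IdealSheafData.coe_support_inter K ⟨U, hU⟩, Set.eq_empty_iff_forall_notMem]
      rintro y ⟨hy, hyU⟩
      exact hUs hyU hy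
    have h1 := hU.fromSpec_image_zeroLocus (K.ideal ⟨U, hU⟩ : Set Γ(X, U))
    rw [h0, Set.image_eq_empty] at h1
    rw [Ideal.span_singleton_one]
    exact (PrimeSpectrum.zeroLocus_empty_iff_eq_top (I := K.ideal ⟨U, hU⟩)).mp h1

variable {k : Type} [Field k]

/-- `(f ▷ T).left` is a base change of `f.left` along `pr₁ : X' ⊗ T → X'` (file-local copy of
`Morphisms.StageImages.isPullback_whiskerRight_left`, not imported here). [folklore] -/
private theorem isPullback_whiskerRight_left' {X X' : SchemeOver k} (f : X ⟶ X') (T : SchemeOver k) :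
    IsPullback (f ▷ T).left (pullback.fst X.hom T.hom) (pullback.fst X'.hom T.hom) f.left := by
  refine IsPullback.of_right ?_ (Over.whiskerRight_left_fst f)
    (IsPullback.of_hasPullback X'.hom T.hom).flip
  rw [Over.whiskerRight_left_snd, Over.w f]
  exact (IsPullback.of_hasPullback X.hom T.hom).flip

/-- **`ker (f ▷ T) = pr₁⁻¹(ker f) · 𝒪`** for a closed `k`-immersion `f : X ↪ X'` and a `k`-scheme
`T`: the inverse image of the ideal of `X` in `X'` cuts out `X ⊗ T` in `X' ⊗ T`.
[cite: GortzWedhorn2020, Prop. 4.20] -/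
theorem ker_whiskerRight_left {X X' : SchemeOver k} (f : X ⟶ X') [IsClosedImmersion f.left]
    (T : SchemeOver k) :
    (f ▷ T).left.ker = f.left.ker.comap (pullback.fst X'.hom T.hom) := by
  have h := isPullback_whiskerRight_left' f T
  rw [← h.isoPullback_hom_fst, Scheme.Hom.ker_comp_of_isIso,
    Scheme.IdealSheafData.ker_fst_of_isClosedImmersion]
  rfl

/-- **`(f ▷ T)(X ⊗ T) = pr₁⁻¹ f(X)`** set-theoretically. [folklore] -/
theorem range_whiskerRight_left {X X' : SchemeOver k} (f : X ⟶ X') (T : SchemeOver k) :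
    Set.range (f ▷ T).left = pullback.fst X'.hom T.hom ⁻¹' Set.range f.left := by
  have h := isPullback_whiskerRight_left' f T
  rw [← h.isoPullback_hom_fst, Scheme.Hom.comp_base, TopCat.coe_comp,
    h.isoPullback.hom.surjective.range_comp]
  exact Scheme.Pullback.range_fst _ _

end Literature.AlgebraicGeometry.Motives

end
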